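import Mathlib
import HarnessLib

/-!
# Involutive Metropolis with a Jacobian: deterministic flow proposals are exact

HONEST FRAMING: exact (Metropolis-corrected) sampling algorithms for lattice gauge theory;
figures of merit are autocorrelation/cost numbers at stated couplings and volumes; no
continuum-physics claim.

Venture `LatticeQCDFlow` (cell pub-lqcd), topic `Exactness`, FANOUT row 30 (lean-1).  This file
generalises `InvolutiveMetropolis.lean` (volume-PRESERVING involutions: HMC, T-REX) to
involutions with a non-trivial, exactly known JACOBIAN — the structure of "involutive MCMC" with
learned deterministic proposals (field-transformed / flow-augmented HMC à la Lüscher 2010 §6,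
L2HMC-type samplers of Foreman et al. 2021, generalised HMC through a trained bijection; all
named only, nothing cited as a fact).  NEW WORK of the cell over Mathlib's kernel library.

## Content (reference measure `vol`, energy `H : Ω → ℝ`, involution `Φ`, Jacobian `J : Ω → ℝ≥0∞`)

* hypotheses: `Φ ∘ Φ = id`; `Φ_* (J · vol) = vol` (exact Jacobian, cf. `HasJacobian` of
  `FlowPushforward.lean`, restated inline to keep this file Mathlib-only); the involution's
  chain rule `J x · J (Φ x) = 1`;
* `ijAccept H Φ J x = min {1, e^{H x − H (Φ x)} · J x}` — the Metropolis–Hastings–Green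
  acceptance INCLUDING the Jacobian; `ijMH Φ hΦ H J : Kernel Ω Ω` — propose `Φ x`, accept with
  `ijAccept`, else stay;
* `ijMH_isReversible` — the kernel is reversible (`Kernel.IsReversible`) for `e^{−H} · vol`;
  `ijMH_invariant` — hence `e^{−H} vol` is invariant.  Mechanism: the symmetrised weight
  `s(x) = min {e^{−H x}, e^{−H Φx} J x}` satisfies `J y · s(Φ y) = s(y)`, and the Jacobian
  identity substitutes `x = Φ y`.  Forgetting `J` (i.e. accepting with `min{1, e^{−ΔH}}` for a
  non-volume-preserving proposal) breaks exactness — the Jacobian is not optional.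

Not here: stochastic refreshment steps (compose with any `e^{−H} vol`-invariant kernel:
Mathlib's `Kernel.Invariant.comp`), ergodicity, efficiency.
-/

namespace Summit.Ventures.LatticeQCDFlow.Exactness

open MeasureTheory ProbabilityTheory
open scoped ENNReal

variable {Ω : Type*} [MeasurableSpace Ω]

/-! ## Acceptance with Jacobian -/

/-- Metropolis–Hastings–Green acceptance for the deterministic involutive proposal `x ↦ Φ x`
with Jacobian `J`: `min {1, e^{H x − H (Φ x)} · J(x)}` (as an `ℝ≥0∞` value). -/
noncomputable def ijAccept (H : Ω → ℝ) (Φ : Ω → Ω) (J : Ω → ℝ≥0∞) (x : Ω) : ℝ≥0∞ :=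
  min 1 (ENNReal.ofReal (Real.exp (H x - H (Φ x))) * J x)

omit [MeasurableSpace Ω] in
/-- The acceptance is at most one. -/
theorem ijAccept_le_one (H : Ω → ℝ) (Φ : Ω → Ω) (J : Ω → ℝ≥0∞) (x : Ω) :
    ijAccept H Φ J x ≤ 1 := min_le_left _ _

/-- Measurability of the acceptance. -/
theorem measurable_ijAccept {H : Ω → ℝ} {Φ : Ω → Ω} {J : Ω → ℝ≥0∞} (hH : Measurable H)
    (hΦ : Measurable Φ) (hJ : Measurable J) : Measurable (ijAccept H Φ J) := by
  unfold ijAccept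
  exact measurable_const.min
    ((Real.measurable_exp.comp (hH.sub (hH.comp hΦ))).ennreal_ofReal.mul hJ)

/-- The symmetrised weight `s(x) = e^{−H x} · a(x) = min {e^{−H x}, e^{−H (Φ x)} · J(x)}`. -/
noncomputable def ijWeight (H : Ω → ℝ) (Φ : Ω → Ω) (J : Ω → ℝ≥0∞) (x : Ω) : ℝ≥0∞ :=
  min (ENNReal.ofReal (Real.exp (-H x))) (ENNReal.ofReal (Real.exp (-H (Φ x))) * J x)

omit [MeasurableSpace Ω] in
/-- `e^{−H x} · a(x) = s(x)`. -/
theorem exp_mul_ijAccept (H : Ω → ℝ) (Φ : Ω → Ω) (J : Ω → ℝ≥0∞) (x : Ω) :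
    ENNReal.ofReal (Real.exp (-H x)) * ijAccept H Φ J x = ijWeight H Φ J x := by
  unfold ijAccept ijWeight
  rw [← min_mul_mul_left, mul_one, ← mul_assoc, ← ENNReal.ofReal_mul (Real.exp_pos _).le,
    ← Real.exp_add]
  congr 3
  ring

/-- Measurability of the symmetrised weight. -/
theorem measurable_ijWeight {H : Ω → ℝ} {Φ : Ω → Ω} {J : Ω → ℝ≥0∞} (hH : Measurable H)
    (hΦ : Measurable Φ) (hJ : Measurable J) : Measurable (ijWeight H Φ J) := by
  unfold ijWeight
  exact (Real.measurable_exp.comp hH.neg).ennreal_ofReal.min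
    ((Real.measurable_exp.comp (hH.comp hΦ).neg).ennreal_ofReal.mul hJ)

omit [MeasurableSpace Ω] in
/-- **The detailed-balance identity**: for an involution whose Jacobian satisfies the chain rule
`J y · J (Φ y) = 1`, `J y · s(Φ y) = s(y)`. -/
theorem jac_mul_ijWeight_involutive {H : Ω → ℝ} {Φ : Ω → Ω} {J : Ω → ℝ≥0∞}
    (hinv : Function.Involutive Φ) (hJJ : ∀ x, J x * J (Φ x) = 1) (y : Ω) :
    J y * ijWeight H Φ J (Φ y) = ijWeight H Φ J y := by
  unfold ijWeight
  rw [hinv y, ← min_mul_mul_left, min_comm]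
  congr 1
  · rw [mul_comm (J y), mul_assoc, mul_comm (J (Φ y)), hJJ y, mul_one]
  · rw [mul_comm]

/-! ## The kernel -/

/-- **Involutive Metropolis–Hastings–Green kernel**: propose `Φ x`, accept with
`min {1, e^{H x − H (Φ x)} J(x)}`, else stay. -/
noncomputable def ijMH (Φ : Ω → Ω) (hΦ : Measurable Φ) (H : Ω → ℝ) (J : Ω → ℝ≥0∞) :
    Kernel Ω Ω :=
  Kernel.withDensity (Kernel.deterministic Φ hΦ) (fun x _ => ijAccept H Φ J x) +
    Kernel.withDensity (Kernel.deterministic id measurable_id) (fun x _ => 1 - ijAccept H Φ J x)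

variable {Φ : Ω → Ω} {hΦ : Measurable Φ} {H : Ω → ℝ} {J : Ω → ℝ≥0∞}

/-- Set-wise formula: `K(x, B) = a(x) 1_B(Φ x) + (1 − a(x)) 1_B(x)`. -/
theorem ijMH_apply (hH : Measurable H) (hJ : Measurable J) (x : Ω) {B : Set Ω}
    (hB : MeasurableSet B) :
    ijMH Φ hΦ H J x B =
      ijAccept H Φ J x * B.indicator 1 (Φ x) + (1 - ijAccept H Φ J x) * B.indicator 1 x := by
  have h1 : Measurable (Function.uncurry fun (x : Ω) (_ : Ω) => ijAccept H Φ J x) :=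
    (measurable_ijAccept hH hΦ hJ).comp measurable_fst
  have h2 : Measurable (Function.uncurry fun (x : Ω) (_ : Ω) => 1 - ijAccept H Φ J x) :=
    measurable_const.sub ((measurable_ijAccept hH hΦ hJ).comp measurable_fst)
  rw [ijMH, Kernel.add_apply, Measure.add_apply, Kernel.withDensity_apply' _ h1,
    Kernel.withDensity_apply' _ h2, Kernel.deterministic_apply, Kernel.deterministic_apply,
    setLIntegral_const, setLIntegral_const, id, Measure.dirac_apply' _ hB,
    Measure.dirac_apply' _ hB]

/-- The kernel is Markov. -/
instance instIsMarkovKernelIjMH [Fact (Measurable H)] [Fact (Measurable J)] :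
    IsMarkovKernel (ijMH Φ hΦ H J) := by
  refine ⟨fun x => ⟨?_⟩⟩
  rw [ijMH_apply Fact.out Fact.out x MeasurableSet.univ, Set.indicator_univ, Pi.one_apply,
    Pi.one_apply, mul_one, mul_one]
  exact add_tsub_cancel_of_le (ijAccept_le_one H Φ J x)

/-! ## Reversibility -/

/-- The mass flow `∫_A K(x, B) e^{−H} dvol` = move part `∫_{Φ⁻¹B ∩ A} s dvol` + diagonal part. -/
theorem setLIntegral_ijMH {vol : Measure Ω} (hH : Measurable H) (hJ : Measurable J) {A B : Set Ω}
    (hA : MeasurableSet A) (hB : MeasurableSet B) :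
    ∫⁻ x in A, ijMH Φ hΦ H J x B ∂(vol.withDensity fun x => ENNReal.ofReal (Real.exp (-H x))) =
      (∫⁻ x in Φ ⁻¹' B ∩ A, ijWeight H Φ J x ∂vol) +
        ∫⁻ x in B ∩ A, ENNReal.ofReal (Real.exp (-H x)) * (1 - ijAccept H Φ J x) ∂vol := by
  have hd : Measurable fun x => ENNReal.ofReal (Real.exp (-H x)) :=
    (Real.measurable_exp.comp hH.neg).ennreal_ofReal
  have ha : Measurable (ijAccept H Φ J) := measurable_ijAccept hH hΦ hJ
  have hK : Measurable fun x => ijMH Φ hΦ H J x B := Kernel.measurable_coe _ hB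
  rw [setLIntegral_withDensity_eq_setLIntegral_mul _ hd hK hA]
  simp only [Pi.mul_apply]
  have hpt : ∀ x, ENNReal.ofReal (Real.exp (-H x)) * ijMH Φ hΦ H J x B =
      (Φ ⁻¹' B).indicator (ijWeight H Φ J) x +
        B.indicator (fun x => ENNReal.ofReal (Real.exp (-H x)) * (1 - ijAccept H Φ J x)) x := by
    intro x
    rw [ijMH_apply hH hJ x hB, mul_add, ← mul_assoc, exp_mul_ijAccept]
    congr 1
    · by_cases hx : Φ x ∈ B
      · rw [Set.indicator_of_mem hx, Set.indicator_of_mem (show x ∈ Φ ⁻¹' B from hx),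
          Pi.one_apply, mul_one]
      · rw [Set.indicator_of_notMem hx, Set.indicator_of_notMem (show x ∉ Φ ⁻¹' B from hx),
          mul_zero]
    · by_cases hx : x ∈ B
      · rw [Set.indicator_of_mem hx, Set.indicator_of_mem hx, Pi.one_apply, mul_one]
      · rw [Set.indicator_of_notMem hx, Set.indicator_of_notMem hx, mul_zero, mul_zero]
  simp_rw [hpt]
  have hind : Measurable
      (B.indicator fun x => ENNReal.ofReal (Real.exp (-H x)) * (1 - ijAccept H Φ J x)) :=
    (hd.mul (measurable_const.sub ha)).indicator hB
  rw [lintegral_add_right _ hind, lintegral_indicator hB, Measure.restrict_restrict hB,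
    lintegral_indicator (hΦ hB), Measure.restrict_restrict (hΦ hB)]

/-- Change of variables along the involution: `∫_S s dvol = ∫_{Φ⁻¹ S} J · (s ∘ Φ) dvol` when
`Φ_* (J vol) = vol`. -/
theorem setLIntegral_eq_preimage_jac {vol : Measure Ω} (hΦm : Measurable Φ)
    (hjac : Measure.map Φ (vol.withDensity J) = vol)
    (hJ : Measurable J) {g : Ω → ℝ≥0∞} (hg : Measurable g) {S : Set Ω} (hS : MeasurableSet S) :
    ∫⁻ x in S, g x ∂vol = ∫⁻ y in Φ ⁻¹' S, J y * g (Φ y) ∂vol := by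
  have hgΦ : Measurable fun x => g (Φ x) := hg.comp hΦm
  conv_lhs => rw [← hjac]
  rw [setLIntegral_map hS hg hΦm,
    setLIntegral_withDensity_eq_setLIntegral_mul _ hJ hgΦ (hΦm hS)]
  rfl

/-- **Involutive Metropolis–Hastings–Green is exact.**  If `Φ` is a measurable involution with
exact Jacobian `J` (`Φ_* (J · vol) = vol`) satisfying the chain rule `J x · J (Φ x) = 1`, then
the kernel `ijMH Φ hΦ H J` — propose `Φ x`, accept with `min {1, e^{H x − H Φx} J x}` — is
reversible with respect to `e^{−H} · vol`, for every measurable `H`. -/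
theorem ijMH_isReversible {vol : Measure Ω} (hH : Measurable H) (hJ : Measurable J)
    (hinv : Function.Involutive Φ) (hjac : Measure.map Φ (vol.withDensity J) = vol)
    (hJJ : ∀ x, J x * J (Φ x) = 1) :
    Kernel.IsReversible (ijMH Φ hΦ H J)
      (vol.withDensity fun x => ENNReal.ofReal (Real.exp (-H x))) := by
  intro A B hA hB
  rw [setLIntegral_ijMH hH hJ hA hB, setLIntegral_ijMH hH hJ hB hA, Set.inter_comm B A]
  congr 1
  have hs : Measurable (ijWeight H Φ J) := measurable_ijWeight hH hΦ hJ
  have hpre : Φ ⁻¹' (Φ ⁻¹' A ∩ B) = Φ ⁻¹' B ∩ A := by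
    ext x
    simp only [Set.mem_preimage, Set.mem_inter_iff, hinv x]
    exact and_comm
  rw [setLIntegral_eq_preimage_jac hΦ hjac hJ hs ((hΦ hA).inter hB), hpre]
  refine setLIntegral_congr_fun ((hΦ hB).inter hA) (fun y _ => ?_)
  rw [jac_mul_ijWeight_involutive hinv hJJ]

/-- **Exactness**: `e^{−H} vol` is invariant under the involutive MHG kernel. -/
theorem ijMH_invariant {vol : Measure Ω} (hH : Measurable H) (hJ : Measurable J)
    (hinv : Function.Involutive Φ) (hjac : Measure.map Φ (vol.withDensity J) = vol)
    (hJJ : ∀ x, J x * J (Φ x) = 1) :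
    Kernel.Invariant (ijMH Φ hΦ H J) (vol.withDensity fun x => ENNReal.ofReal (Real.exp (-H x))) := by
  haveI : Fact (Measurable H) := ⟨hH⟩
  haveI : Fact (Measurable J) := ⟨hJ⟩
  exact (ijMH_isReversible hH hJ hinv hjac hJJ).invariant

end Summit.Ventures.LatticeQCDFlow.Exactness
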